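import Mathlib
import Literature.NumberTheory.LFunctions.Zhang2022.SkeletonPartThree
import Literature.NumberTheory.LFunctions.Zhang2022.TypedAppendixB
import Literature.NumberTheory.LFunctions.Zhang2022.AppendixBLemma151ZetaRatioBounds

/-!
# Zhang (2022) Appendix B, proof of Lemma 15.1, `μ = 2`: the integrand
# `intB2 = ζ(1+s)/ζ(1+s−β_j)·(P₂/l₁)ˢ/((log P₂)(s−β₇)²)` right of the imaginary axis —
# holomorphy, an integrable majorant on vertical lines, horizontal decay

Topic `Literature/NumberTheory/LFunctions/Zhang2022` (Landau–Siegel audit tree; verdict-neutral).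
Y. Zhang, *Discrete mean estimates and the Landau–Siegel zero*, arXiv:2211.02515v1 (2022)
[Zhang2022LandauSiegel] — **an unrefereed manuscript under adjudication; nothing in this file
asserts any claim of the manuscript.** ZHANG-L discharge lane (WP15, App. B block B1 under the
leaf `Typed.Section15C.Eq15_22`), DAG node `Z22:§B.u009` [Z22 p.107, tex L5298]: the analytic
inputs for moving the line `Re s = 1` of `intB2 c′ D j l₁` to `Re s = ε` (tree
`Literature.Analysis.Complex.integral_vertical_eq_of_differentiableOn`) and for bounding the tails:

* `differentiableAt_intB2` — `intB2` is complex differentiable at every `s` with `Re s > 0`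
  (`ζ(1+s−β_j) ≠ 0` there, `Re β_j = Re β₇ = 0`);
* `norm_kerB_eq` — `‖(P₂/l₁)ˢ/((log P₂)(s−β₇)²)‖ = (P₂/l₁)^{Re s}/((log P₂)‖s−β₇‖²)`;
* `norm_intB2_le_majorant` — for `0 < σ ≤ 1`, `|t| ≥ t₀`:
  `‖intB2(σ+it)‖ ≤ (C/log P₂)·(P₂/l₁)^σ·(1+|t|)^{−3/2}` with `C = C(t₀, M)` explicit
  (`AppendixBLemma151ZetaRatioBounds` + `log|t| ≤ 16|t|^{1/16}`);
* `integrable_intB2_line` — `t ↦ intB2(σ+it)` is integrable for `0 < σ ≤ 1` (continuity on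
  `[−t₀,t₀]`, the majorant outside; `(1+|t|)^{−3/2}` is integrable, Mathlib
  `integrable_one_add_norm`);
* `intB2_horizontal_decay` — `sup_{x∈[ε,1]} ‖intB2(x+iT)‖ → 0` as `|T| → ∞`.

WHAT THIS IS NOT: the contour identity and the final estimate `StepB_u009rR` (next file), or any
claim about Theorems 1–2 / Landau–Siegel zeros.

## References

* Y. Zhang, arXiv:2211.02515v1 (2022), App. B p. 107. [cite: Zhang2022LandauSiegel, App. B p.107]
* E. C. Titchmarsh, *The Theory of the Riemann Zeta-Function* (1986), Thm. 3.5, §3.6. [Titchmarsh1986]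
-/

noncomputable section

open Complex Real Metric Set Filter Topology MeasureTheory

namespace Literature.NumberTheory.LFunctions.Zhang2022.Skeleton

open Typed.AppendixB (zetaRatio kerB intB2)

section LineShiftBounds

variable (c' : ℝ)

/-- `intB2 = zetaRatio · kerB`, as functions. [cite: Zhang2022LandauSiegel, App. B p.107] -/
theorem intB2_eq_mul (D j l₁ : ℕ) :
    intB2 c' D j l₁ = fun s => zetaRatio c' D j s * kerB (P2 D) (beta7 D) l₁ s := rfl

/-- **Holomorphy right of the imaginary axis**: for `Re s > 0` (with `log P₂ ≠ 0`, `P₂/l₁ > 0`,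
`Re β_j = 0`, `Re β₇ = 0`), `intB2` is complex differentiable at `s` — `ζ(1+s)` is away from its pole,
`ζ(1+s−β_j) ≠ 0` as `Re(1+s−β_j) > 1`, and `s ≠ β₇`. [cite: Zhang2022LandauSiegel, App. B p.107] -/
theorem differentiableAt_intB2 (D j l₁ : ℕ) (hL : Real.log (P2 D) ≠ 0) (hx : 0 < P2 D / l₁)
    (hbre : (betaJ c' D j).re = 0) (hβre : (beta7 D).re = 0) {s : ℂ} (hs : 0 < s.re) :
    DifferentiableAt ℂ (intB2 c' D j l₁) s := by
  have hs0 : s ≠ 0 := by intro h; rw [h] at hs; simp at hs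
  have h1 : (1 : ℂ) + s ≠ 1 := fun h => hs0 (by linear_combination h)
  have hsb : s ≠ betaJ c' D j := by intro h; rw [h, hbre] at hs; exact lt_irrefl _ hs
  have h2 : (1 : ℂ) + s - betaJ c' D j ≠ 1 := fun h => hsb (by linear_combination h)
  have hre2 : 1 < ((1 : ℂ) + s - betaJ c' D j).re := by simp [hbre]; linarith
  have hζ2 : riemannZeta (1 + s - betaJ c' D j) ≠ 0 := riemannZeta_ne_zero_of_one_lt_re hre2
  have hsβ : s - beta7 D ≠ 0 := by
    intro h; have := congrArg Complex.re h; simp [hβre] at this; linarith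
  have hx0 : ((P2 D / l₁ : ℝ) : ℂ) ≠ 0 := by exact_mod_cast hx.ne'
  have hL' : (Real.log (P2 D) : ℂ) ≠ 0 := by exact_mod_cast hL
  rw [intB2_eq_mul]
  refine DifferentiableAt.mul ?_ ?_
  · show DifferentiableAt ℂ (fun s => riemannZeta (1 + s) / riemannZeta (1 + s - betaJ c' D j)) s
    refine DifferentiableAt.div ?_ ?_ hζ2
    · exact (differentiableAt_riemannZeta h1).comp s (differentiableAt_id.const_add _)
    · exact (differentiableAt_riemannZeta h2).comp s ((differentiableAt_id.const_add _).sub_const _)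
  · show DifferentiableAt ℂ (fun s => ((P2 D / l₁ : ℝ) : ℂ) ^ s /
      ((Real.log (P2 D) : ℂ) * (s - beta7 D) ^ 2)) s
    refine DifferentiableAt.div (differentiableAt_id.const_cpow (Or.inl hx0)) ?_
      (mul_ne_zero hL' (pow_ne_zero _ hsβ))
    exact (differentiableAt_const _).mul ((differentiableAt_id.sub_const _).pow 2)

/-- `t ↦ intB2(σ + it)` is continuous for `σ > 0`. [cite: Zhang2022LandauSiegel, App. B p.107] -/
theorem continuous_intB2_line (D j l₁ : ℕ) (hL : Real.log (P2 D) ≠ 0) (hx : 0 < P2 D / l₁)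
    (hbre : (betaJ c' D j).re = 0) (hβre : (beta7 D).re = 0) {σ : ℝ} (hσ : 0 < σ) :
    Continuous fun t : ℝ => intB2 c' D j l₁ (σ + t * I) := by
  have hline : Continuous fun t : ℝ => (σ : ℂ) + t * I := by fun_prop
  refine continuous_iff_continuousAt.mpr fun t => ?_
  have hd := differentiableAt_intB2 c' D j l₁ hL hx hbre hβre (s := σ + t * I) (by simpa using hσ)
  exact ContinuousAt.comp (f := fun t : ℝ => (σ : ℂ) + t * I) (x := t) hd.continuousAt
    hline.continuousAt

/-- **The kernel's size**: `‖(P₂/l₁)ˢ/((log P₂)(s−β₇)²)‖ = (P₂/l₁)^{Re s}/((log P₂)·‖s−β₇‖²)`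
(`P₂/l₁ > 0`, `log P₂ > 0`). [cite: Zhang2022LandauSiegel, App. B p.107] -/
theorem norm_kerB_eq (D l₁ : ℕ) (hL : 0 < Real.log (P2 D)) (hx : 0 < P2 D / l₁) (β s : ℂ) :
    ‖kerB (P2 D) β l₁ s‖ = (P2 D / l₁) ^ s.re / (Real.log (P2 D) * ‖s - β‖ ^ 2) := by
  rw [kerB, norm_div, norm_mul, norm_pow, Complex.norm_cpow_eq_rpow_re_of_pos hx,
    Complex.norm_real, Real.norm_eq_abs, abs_of_pos hL]

/-- `log⁸|t| ≤ 16⁸·(1+|t|)^{1/2}·…`: precisely `log|t|^8/t² ≤ 4·16⁸·(1+|t|)^{−3/2}` for `|t| ≥ 5`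
(`log u ≤ 16u^{1/16}`, `1 + |t| ≤ 2|t|`). [folklore] -/
private theorem log_pow_eight_div_sq_le {t : ℝ} (ht : 5 ≤ |t|) :
    Real.log |t| ^ 8 / t ^ 2 ≤ 4 * 16 ^ 8 * (1 + |t|) ^ (-(3 / 2 : ℝ)) := by
  have ht0 : 0 < |t| := by linarith
  have hu0 : 0 < 1 + |t| := by linarith
  have hlog0 : 0 ≤ Real.log |t| := Real.log_nonneg (by linarith)
  -- `log|t| ≤ 16 |t|^{1/16} ≤ 16 (1+|t|)^{1/16}`
  have h1 : Real.log |t| ≤ 16 * (1 + |t|) ^ (1 / 16 : ℝ) := by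
    have h := Real.log_le_rpow_div (abs_nonneg t) (show (0:ℝ) < 1 / 16 by norm_num)
    have hmono : |t| ^ (1 / 16 : ℝ) ≤ (1 + |t|) ^ (1 / 16 : ℝ) :=
      Real.rpow_le_rpow (abs_nonneg t) (by linarith) (by norm_num)
    calc Real.log |t| ≤ |t| ^ (1 / 16 : ℝ) / (1 / 16) := h
      _ = 16 * |t| ^ (1 / 16 : ℝ) := by ring
      _ ≤ 16 * (1 + |t|) ^ (1 / 16 : ℝ) := by linarith
  have hexp : ((1 + |t|) ^ (1 / 16 : ℝ)) ^ (8 : ℕ) = (1 + |t|) ^ (1 / 2 : ℝ) := by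
    rw [← Real.rpow_natCast, ← Real.rpow_mul hu0.le]
    norm_num
  have h8 : Real.log |t| ^ 8 ≤ 16 ^ 8 * (1 + |t|) ^ (1 / 2 : ℝ) := by
    calc Real.log |t| ^ 8 ≤ (16 * (1 + |t|) ^ (1 / 16 : ℝ)) ^ 8 := pow_le_pow_left₀ hlog0 h1 8
      _ = 16 ^ 8 * (1 + |t|) ^ (1 / 2 : ℝ) := by rw [mul_pow, hexp]
  -- `1/t² ≤ 4/(1+|t|)²`
  have hsq : t ^ 2 = |t| ^ 2 := (sq_abs t).symm
  have h2 : 1 / t ^ 2 ≤ 4 / (1 + |t|) ^ 2 := by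
    rw [hsq, div_le_div_iff₀ (by positivity) (by positivity)]
    nlinarith
  have hpow : (1 + |t|) ^ (1 / 2 : ℝ) / (1 + |t|) ^ 2 = (1 + |t|) ^ (-(3 / 2 : ℝ)) := by
    rw [show ((1 + |t|) ^ 2 : ℝ) = (1 + |t|) ^ (2 : ℝ) by norm_cast, ← Real.rpow_sub hu0]
    norm_num
  calc Real.log |t| ^ 8 / t ^ 2 = Real.log |t| ^ 8 * (1 / t ^ 2) := by ring
    _ ≤ (16 ^ 8 * (1 + |t|) ^ (1 / 2 : ℝ)) * (4 / (1 + |t|) ^ 2) :=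
        mul_le_mul h8 h2 (by positivity) (by positivity)
    _ = 4 * 16 ^ 8 * ((1 + |t|) ^ (1 / 2 : ℝ) / (1 + |t|) ^ 2) := by ring
    _ = 4 * 16 ^ 8 * (1 + |t|) ^ (-(3 / 2 : ℝ)) := by rw [hpow]

/-- `1 ≤ 36 (1+|t|)^{−3/2}` for `|t| ≤ 5`. [folklore] -/
private theorem one_le_rpow_near {t : ℝ} (ht : |t| ≤ 5) : (1 : ℝ) ≤ 36 * (1 + |t|) ^ (-(3 / 2 : ℝ)) := by
  have hu1 : (1 : ℝ) ≤ 1 + |t| := by linarith [abs_nonneg t]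
  have hu0 : (0 : ℝ) < 1 + |t| := by linarith
  have h1 : (1 + |t|) ^ (-(2 : ℝ)) ≤ (1 + |t|) ^ (-(3 / 2 : ℝ)) :=
    Real.rpow_le_rpow_of_exponent_le hu1 (by norm_num)
  have h2 : (1 + |t|) ^ (-(2 : ℝ)) = 1 / (1 + |t|) ^ 2 := by
    rw [Real.rpow_neg hu0.le, show ((1 + |t|) ^ (2 : ℝ) : ℝ) = (1 + |t|) ^ 2 by norm_cast, one_div]
  have h3 : (1 : ℝ) / 36 ≤ 1 / (1 + |t|) ^ 2 := by
    apply div_le_div_of_nonneg_left zero_le_one (by positivity)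
    nlinarith [abs_nonneg t]
  linarith

/-- **An integrable majorant on the vertical lines `0 < Re s ≤ 1`, away from the real axis**: with
`M` a bound for `1/ζ` on `{1 ≤ Re ≤ 2, t₀/2 ≤ |Im| ≤ 6}` (`0 < t₀ ≤ 1`), `|β_j| ≤ t₀/2` purely
imaginary, `β₇ = 5iα/2` with `5α ≤ t₀`: for `0 < σ ≤ 1` and `|t| ≥ t₀`,
`‖intB2(σ+it)‖ ≤ (C/log P₂)(P₂/l₁)^σ(1+|t|)^{−3/2}`, `C = 256·16⁸·K + 36·196M/t₀³`.
[cite: Zhang2022LandauSiegel, App. B p.107] -/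
theorem norm_intB2_le_majorant (D j l₁ : ℕ) {t₀ M : ℝ} (ht₀ : 0 < t₀) (ht₀1 : t₀ ≤ 1) (hM0 : 0 ≤ M)
    (hM : ∀ w : ℂ, 1 ≤ w.re → w.re ≤ 2 → t₀ / 2 ≤ |w.im| → |w.im| ≤ 6 → ‖(riemannZeta w)⁻¹‖ ≤ M)
    (hb : ‖betaJ c' D j‖ ≤ t₀ / 2) (hbre : (betaJ c' D j).re = 0)
    (hβ : beta7 D = (((5 * alpha D / 2 : ℝ)) : ℂ) * I) (hα0 : 0 < alpha D) (hαt : 5 * alpha D ≤ t₀)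
    (hL : 0 < Real.log (P2 D)) (hx : 0 < P2 D / l₁)
    {σ t : ℝ} (hσ0 : 0 < σ) (hσ1 : σ ≤ 1) (ht : t₀ ≤ |t|) :
    ‖intB2 c' D j l₁ (σ + t * I)‖ ≤
      (256 * 16 ^ 8 * (1134 * 16 * 336 ^ 4) + 36 * (196 * M / t₀ ^ 3)) / Real.log (P2 D) *
        (P2 D / l₁) ^ σ * (1 + |t|) ^ (-(3 / 2 : ℝ)) := by
  set K : ℝ := 1134 * 16 * 336 ^ 4 with hKdef
  set L : ℝ := Real.log (P2 D) with hLdef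
  set y : ℝ := P2 D / l₁ with hydef
  set a : ℝ := alpha D with hadef
  have hK0 : 0 < K := by rw [hKdef]; norm_num
  have hyσ : 0 < y ^ σ := Real.rpow_pos_of_pos hx σ
  have hu0 : 0 < 1 + |t| := by linarith [abs_nonneg t]
  have hrp0 : 0 < (1 + |t|) ^ (-(3 / 2 : ℝ)) := Real.rpow_pos_of_pos hu0 _
  -- the kernel
  have hsβ : (↑σ + ↑t * I) - beta7 D = ((σ : ℝ) : ℂ) + ((t - 5 * a / 2 : ℝ) : ℂ) * I := by
    rw [hβ]; push_cast; ring
  have hnsβ : |t - 5 * a / 2| ≤ ‖(↑σ + ↑t * I) - beta7 D‖ := by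
    rw [hsβ]; simpa using Complex.abs_im_le_norm (((σ : ℝ) : ℂ) + ((t - 5 * a / 2 : ℝ) : ℂ) * I)
  have hker : ‖kerB (P2 D) (beta7 D) l₁ (σ + t * I)‖ = y ^ σ / (L * ‖(↑σ + ↑t * I) - beta7 D‖ ^ 2) := by
    rw [norm_kerB_eq D l₁ hL hx]; simp [hydef, hLdef]
  have hhalf : |t| / 2 ≤ |t - 5 * a / 2| := by
    have h1 := abs_sub_abs_le_abs_sub t (5 * a / 2)
    have h2 : |5 * a / 2| = 5 * a / 2 := abs_of_pos (by positivity)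
    have h3 : 5 * a / 2 ≤ |t| / 2 := by linarith
    linarith
  have ht0 : 0 < |t| := lt_of_lt_of_le ht₀ ht
  have hden : (|t| / 2) ^ 2 ≤ ‖(↑σ + ↑t * I) - beta7 D‖ ^ 2 :=
    pow_le_pow_left₀ (by positivity) (hhalf.trans hnsβ) 2
  have hden0 : 0 < ‖(↑σ + ↑t * I) - beta7 D‖ ^ 2 := lt_of_lt_of_le (by positivity) hden
  have hker_le : ‖kerB (P2 D) (beta7 D) l₁ (σ + t * I)‖ ≤ y ^ σ / (L * (|t| / 2) ^ 2) := by
    rw [hker]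
    exact div_le_div_of_nonneg_left hyσ.le (by positivity) (by gcongr)
  rw [intB2_eq_mul]
  simp only []
  rw [norm_mul]
  rcases le_or_gt 5 |t| with h5 | h5
  · -- far range
    have hb1 : ‖betaJ c' D j‖ ≤ 1 := by linarith
    have hZ := norm_zetaRatio_le_far c' D j hb1 hbre hσ0 hσ1 h5
    have hlog := log_pow_eight_div_sq_le h5
    have hlogpos : 0 ≤ Real.log |t| ^ 8 := pow_nonneg (Real.log_nonneg (by linarith)) 8
    calc ‖zetaRatio c' D j (↑σ + ↑t * I)‖ * ‖kerB (P2 D) (beta7 D) l₁ (↑σ + ↑t * I)‖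
        ≤ (16 * K * Real.log |t| ^ 8) * (y ^ σ / (L * (|t| / 2) ^ 2)) :=
          mul_le_mul hZ hker_le (norm_nonneg _) (by positivity)
      _ = 16 * K * 4 * (y ^ σ / L) * (Real.log |t| ^ 8 / t ^ 2) := by
          rw [show t ^ 2 = |t| ^ 2 from (sq_abs t).symm]
          field_simp
          ring
      _ ≤ 16 * K * 4 * (y ^ σ / L) * (4 * 16 ^ 8 * (1 + |t|) ^ (-(3 / 2 : ℝ))) := by
          gcongr
      _ = 256 * 16 ^ 8 * K / L * y ^ σ * (1 + |t|) ^ (-(3 / 2 : ℝ)) := by ring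
      _ ≤ (256 * 16 ^ 8 * K + 36 * (196 * M / t₀ ^ 3)) / L * y ^ σ *
            (1 + |t|) ^ (-(3 / 2 : ℝ)) := by
          have : 0 ≤ 36 * (196 * M / t₀ ^ 3) / L * y ^ σ * (1 + |t|) ^ (-(3 / 2 : ℝ)) := by
            positivity
          have hsplit : (256 * 16 ^ 8 * K + 36 * (196 * M / t₀ ^ 3)) / L * y ^ σ *
              (1 + |t|) ^ (-(3 / 2 : ℝ)) =
              256 * 16 ^ 8 * K / L * y ^ σ * (1 + |t|) ^ (-(3 / 2 : ℝ)) +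
                36 * (196 * M / t₀ ^ 3) / L * y ^ σ * (1 + |t|) ^ (-(3 / 2 : ℝ)) := by ring
          linarith
  · -- near range
    have ht5 : |t| ≤ 5 := h5.le
    have hZ := norm_zetaRatio_le_near c' D j ht₀ (by linarith) hM hb hbre hσ0 hσ1 ht ht5
    have hker_le' : ‖kerB (P2 D) (beta7 D) l₁ (σ + t * I)‖ ≤ y ^ σ / (L * (t₀ / 2) ^ 2) := by
      refine hker_le.trans ?_
      exact div_le_div_of_nonneg_left hyσ.le (by positivity) (by gcongr)
    have h36 := one_le_rpow_near ht5
    calc ‖zetaRatio c' D j (↑σ + ↑t * I)‖ * ‖kerB (P2 D) (beta7 D) l₁ (↑σ + ↑t * I)‖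
        ≤ (49 / t₀ * M) * (y ^ σ / (L * (t₀ / 2) ^ 2)) :=
          mul_le_mul hZ hker_le' (norm_nonneg _) (by positivity)
      _ = (196 * M / t₀ ^ 3) / L * y ^ σ * 1 := by field_simp; ring
      _ ≤ (196 * M / t₀ ^ 3) / L * y ^ σ * (36 * (1 + |t|) ^ (-(3 / 2 : ℝ))) := by
          gcongr
      _ = 36 * (196 * M / t₀ ^ 3) / L * y ^ σ * (1 + |t|) ^ (-(3 / 2 : ℝ)) := by ring
      _ ≤ (256 * 16 ^ 8 * K + 36 * (196 * M / t₀ ^ 3)) / L * y ^ σ *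
            (1 + |t|) ^ (-(3 / 2 : ℝ)) := by
          have : 0 ≤ 256 * 16 ^ 8 * K / L * y ^ σ * (1 + |t|) ^ (-(3 / 2 : ℝ)) := by
            positivity
          have hsplit : (256 * 16 ^ 8 * K + 36 * (196 * M / t₀ ^ 3)) / L * y ^ σ *
              (1 + |t|) ^ (-(3 / 2 : ℝ)) =
              256 * 16 ^ 8 * K / L * y ^ σ * (1 + |t|) ^ (-(3 / 2 : ℝ)) +
                36 * (196 * M / t₀ ^ 3) / L * y ^ σ * (1 + |t|) ^ (-(3 / 2 : ℝ)) := by ring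
          linarith

/-- The majorant `(1 + |t|)^{−3/2}` is integrable on `ℝ` (Mathlib's `integrable_one_add_norm` on the
line). [cite: Zhang2022LandauSiegel, App. B p.107] -/
theorem integrable_one_add_abs_rpow : Integrable fun t : ℝ => (1 + |t|) ^ (-(3 / 2 : ℝ)) := by
  have h := integrable_one_add_norm (E := ℝ) (μ := volume) (r := 3 / 2)
    (by rw [Module.finrank_self]; norm_num)
  simpa [Real.norm_eq_abs] using h

/-- **Integrability along the vertical lines `0 < Re s ≤ 1`** (under the hypotheses of
`norm_intB2_le_majorant`): `t ↦ intB2(σ+it)` is integrable on `ℝ` — continuous on `[−t₀, t₀]`,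
dominated by the integrable majorant outside. [cite: Zhang2022LandauSiegel, App. B p.107] -/
theorem integrable_intB2_line (D j l₁ : ℕ) {t₀ M : ℝ} (ht₀ : 0 < t₀) (ht₀1 : t₀ ≤ 1) (hM0 : 0 ≤ M)
    (hM : ∀ w : ℂ, 1 ≤ w.re → w.re ≤ 2 → t₀ / 2 ≤ |w.im| → |w.im| ≤ 6 → ‖(riemannZeta w)⁻¹‖ ≤ M)
    (hb : ‖betaJ c' D j‖ ≤ t₀ / 2) (hbre : (betaJ c' D j).re = 0)
    (hβ : beta7 D = (((5 * alpha D / 2 : ℝ)) : ℂ) * I) (hα0 : 0 < alpha D) (hαt : 5 * alpha D ≤ t₀)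
    (hL : 0 < Real.log (P2 D)) (hx : 0 < P2 D / l₁)
    {σ : ℝ} (hσ0 : 0 < σ) (hσ1 : σ ≤ 1) :
    Integrable fun t : ℝ => intB2 c' D j l₁ (σ + t * I) := by
  have hβre : (beta7 D).re = 0 := by rw [hβ]; simp
  have hcont := continuous_intB2_line c' D j l₁ hL.ne' hx hbre hβre hσ0
  set C : ℝ := (256 * 16 ^ 8 * (1134 * 16 * 336 ^ 4) + 36 * (196 * M / t₀ ^ 3)) /
    Real.log (P2 D) * (P2 D / l₁) ^ σ with hC
  have hmaj : ∀ t : ℝ, t₀ ≤ |t| →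
      ‖intB2 c' D j l₁ (σ + t * I)‖ ≤ C * (1 + |t|) ^ (-(3 / 2 : ℝ)) := by
    intro t ht
    have := norm_intB2_le_majorant c' D j l₁ ht₀ ht₀1 hM0 hM hb hbre hβ hα0 hαt hL hx hσ0 hσ1 ht
    rw [hC]; exact this
  have hg : Integrable fun t : ℝ => C * (1 + |t|) ^ (-(3 / 2 : ℝ)) :=
    integrable_one_add_abs_rpow.const_mul C
  -- tails
  have htail : ∀ S : Set ℝ, MeasurableSet S → (∀ t ∈ S, t₀ ≤ |t|) →
      IntegrableOn (fun t : ℝ => intB2 c' D j l₁ (σ + t * I)) S := by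
    intro S hS hSt
    refine Integrable.mono' (hg.integrableOn) hcont.aestronglyMeasurable.restrict ?_
    exact ae_restrict_of_forall_mem hS fun t ht => hmaj t (hSt t ht)
  have h1 : IntegrableOn (fun t : ℝ => intB2 c' D j l₁ (σ + t * I)) (Iic (-t₀)) :=
    htail _ measurableSet_Iic fun t ht => by
      have : t ≤ -t₀ := ht
      rw [abs_of_neg (by linarith)]; linarith
  have h3 : IntegrableOn (fun t : ℝ => intB2 c' D j l₁ (σ + t * I)) (Ioi t₀) :=
    htail _ measurableSet_Ioi fun t ht => by
      have : t₀ < t := ht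
      rw [abs_of_pos (by linarith)]; linarith
  have h2 : IntegrableOn (fun t : ℝ => intB2 c' D j l₁ (σ + t * I)) (Icc (-t₀) t₀) :=
    hcont.continuousOn.integrableOn_Icc
  have hunion := (h1.union h2).union h3
  rw [Iic_union_Icc_eq_Iic (by linarith), Iic_union_Ioi] at hunion
  exact integrableOn_univ.mp hunion

/-- **Horizontal decay** (under the same hypotheses, with `P₂/l₁ ≥ 1`): for every `η > 0` there is
`T₀` with `‖intB2(x + iT)‖ ≤ η` for `|T| ≥ T₀`, uniformly in `x ∈ [ε, 1]` (`0 < ε`).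
[cite: Zhang2022LandauSiegel, App. B p.107] -/
theorem intB2_horizontal_decay (D j l₁ : ℕ) {t₀ M : ℝ} (ht₀ : 0 < t₀) (ht₀1 : t₀ ≤ 1) (hM0 : 0 ≤ M)
    (hM : ∀ w : ℂ, 1 ≤ w.re → w.re ≤ 2 → t₀ / 2 ≤ |w.im| → |w.im| ≤ 6 → ‖(riemannZeta w)⁻¹‖ ≤ M)
    (hb : ‖betaJ c' D j‖ ≤ t₀ / 2) (hbre : (betaJ c' D j).re = 0)
    (hβ : beta7 D = (((5 * alpha D / 2 : ℝ)) : ℂ) * I) (hα0 : 0 < alpha D) (hαt : 5 * alpha D ≤ t₀)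
    (hL : 0 < Real.log (P2 D)) (hx : 1 ≤ P2 D / l₁) {ε : ℝ} (hε : 0 < ε) :
    ∀ η : ℝ, 0 < η → ∃ T₀ : ℝ, ∀ T : ℝ, T₀ ≤ |T| → ∀ x ∈ Icc ε 1,
      ‖intB2 c' D j l₁ (x + T * I)‖ ≤ η := by
  intro η hη
  set C : ℝ := (256 * 16 ^ 8 * (1134 * 16 * 336 ^ 4) + 36 * (196 * M / t₀ ^ 3)) /
    Real.log (P2 D) with hC
  have hC0 : 0 ≤ C := by rw [hC]; positivity
  have hx0 : 0 < P2 D / l₁ := lt_of_lt_of_le one_pos hx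
  refine ⟨max t₀ (max 1 (C * (P2 D / l₁) / η)), fun T hT x hxI => ?_⟩
  have hT0 : t₀ ≤ |T| := le_trans (le_max_left _ _) hT
  have hT1 : 1 ≤ |T| := le_trans (le_trans (le_max_left _ _) (le_max_right _ _)) hT
  have hT2 : C * (P2 D / l₁) / η ≤ |T| := le_trans (le_trans (le_max_right _ _) (le_max_right _ _)) hT
  have hmaj := norm_intB2_le_majorant c' D j l₁ ht₀ ht₀1 hM0 hM hb hbre hβ hα0 hαt hL hx0
    (lt_of_lt_of_le hε hxI.1) hxI.2 hT0
  -- `(P₂/l₁)^x ≤ P₂/l₁` and `(1+|T|)^{-3/2} ≤ 1/|T|`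
  have hpow1 : (P2 D / l₁) ^ x ≤ P2 D / l₁ := by
    calc (P2 D / l₁) ^ x ≤ (P2 D / l₁) ^ (1 : ℝ) := Real.rpow_le_rpow_of_exponent_le hx hxI.2
      _ = P2 D / l₁ := Real.rpow_one _
  have hu1 : (1 : ℝ) ≤ 1 + |T| := by linarith [abs_nonneg T]
  have hpow2 : (1 + |T|) ^ (-(3 / 2 : ℝ)) ≤ 1 / |T| := by
    calc (1 + |T|) ^ (-(3 / 2 : ℝ)) ≤ (1 + |T|) ^ (-(1 : ℝ)) :=
          Real.rpow_le_rpow_of_exponent_le hu1 (by norm_num)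
      _ = 1 / (1 + |T|) := by rw [Real.rpow_neg (by linarith), Real.rpow_one, one_div]
      _ ≤ 1 / |T| := div_le_div_of_nonneg_left zero_le_one (by linarith) (by linarith)
  have hTpos : 0 < |T| := by linarith
  calc ‖intB2 c' D j l₁ (↑x + ↑T * I)‖ ≤ C * (P2 D / l₁) ^ x * (1 + |T|) ^ (-(3 / 2 : ℝ)) := by
        rw [hC]; exact hmaj
    _ ≤ C * (P2 D / l₁) * (1 / |T|) := by gcongr
    _ = (C * (P2 D / l₁) / η) * η / |T| := by field_simp
    _ ≤ |T| * η / |T| := by gcongr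
    _ = η := by field_simp

end LineShiftBounds

end Literature.NumberTheory.LFunctions.Zhang2022.Skeleton
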